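import Summits.ResolutionOfSingularities.ResolutionOfSingularities.Theorems.FrobeniusLadderFInjectiveMacaulayficationF108ToricStar

/-!
# [OURS · L1 W4.5a · F-108 toric infrastructure 3/7] A star subdivision preserves strict concavity, 𝔪-domination and neighbour membership

With the scale `N ≥ 2B + 2`, `B = bnd S τ` bounding `|ρ ⬝ᵥ w|` over the rays of the state (and the new barycentre) and all dual vectors,
the star subdivision `dstar N S τ` at a valid face keeps `sc`, `dom` and `amem`; together with file 2/7 this gives ★ `inv_dstar`:
`Inv S → ValidFace S τ → Inv (dstar N S τ)`.  The content is the toric statement «the pull-back of an ample polarisation scaled by `N`,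
minus the exceptional divisor of the blow-up of a smooth torus-invariant centre, is ample for `N ≫ 0`» (Cox–Little–Schenck §11.1,
§6.1), done on the finite data only.  AI-written; weaker than expert review. Nothing here proves resolution of singularities in positive characteristic.
-/

set_option linter.dupNamespace false

noncomputable section

namespace Summit.ResolutionOfSingularities.ResolutionOfSingularities.Theorems.FInjectiveMacaulayfication.F108Toric

open Matrix Finset

variable {n : ℕ}

/-- The rays of a state together with the barycentre of the face to be starred. [OURS · bookkeeping] -/
def raysPlus (S : Finset (DCone n)) (τ : Finset (Fin n → ℤ)) : Finset (Fin n → ℤ) := S.biUnion DCone.rays ∪ {bary τ}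

/-- The bound `B = max |ρ ⬝ᵥ w_d i|` over `ρ ∈ raysPlus S τ`, `d ∈ S`, `i`. [OURS · bookkeeping] -/
def bnd (S : Finset (DCone n)) (τ : Finset (Fin n → ℤ)) : ℕ :=
  ((S ×ˢ raysPlus S τ) ×ˢ (univ : Finset (Fin n))).sup fun p => (p.1.2 ⬝ᵥ p.1.1.w p.2).natAbs

/-- Rays of the state belong to `raysPlus`. -/
theorem ray_mem_raysPlus {S : Finset (DCone n)} {τ : Finset (Fin n → ℤ)} {d : DCone n} (hd : d ∈ S) (k : Fin n) :
    d.ray k ∈ raysPlus S τ :=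
  mem_union_left _ (mem_biUnion.2 ⟨d, hd, ray_mem_rays d k⟩)

/-- The barycentre belongs to `raysPlus`. -/
theorem bary_mem_raysPlus (S : Finset (DCone n)) (τ : Finset (Fin n → ℤ)) : bary τ ∈ raysPlus S τ :=
  mem_union_right _ (mem_singleton_self _)

/-- `|ρ ⬝ᵥ w_d i| ≤ B`. -/
theorem abs_dot_w_le {S : Finset (DCone n)} {τ : Finset (Fin n → ℤ)} {d : DCone n} (hd : d ∈ S) {ρ : Fin n → ℤ}
    (hρ : ρ ∈ raysPlus S τ) (i : Fin n) : |ρ ⬝ᵥ d.w i| ≤ (bnd S τ : ℤ) := by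
  have hmem : ((d, ρ), i) ∈ (S ×ˢ raysPlus S τ) ×ˢ (univ : Finset (Fin n)) :=
    mem_product.2 ⟨mem_product.2 ⟨hd, hρ⟩, mem_univ i⟩
  have h : (ρ ⬝ᵥ d.w i).natAbs ≤ bnd S τ := by
    unfold bnd
    exact le_sup (f := fun p : (DCone n × (Fin n → ℤ)) × Fin n => (p.1.2 ⬝ᵥ p.1.1.w p.2).natAbs) hmem
  rw [← Int.natCast_natAbs]
  exact_mod_cast h

section sc

variable {S : Finset (DCone n)} (hS : Inv S) {τ : Finset (Fin n → ℤ)}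
include hS

/-- The barycentre pairs LINEARLY along the slots carrying `τ`. -/
theorem Inv.bary_dotProduct {d : DCone n} (hd : d ∈ S) (hτ : τ ⊆ d.rays) (u : Fin n → ℤ) :
    bary τ ⬝ᵥ u = ∑ k ∈ univ.filter (fun k => d.ray k ∈ τ), d.ray k ⬝ᵥ u := by
  rw [hS.bary_eq_sum hd hτ, sum_dotProduct']

/-- The gap of the barycentre of an affected cone `d` against `d'` vanishes iff `d'` is affected too. -/
theorem Inv.bary_gap {d d' : DCone n} (hd : d ∈ S) (hd' : d' ∈ S) (hτ : τ ⊆ d.rays) :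
    0 ≤ bary τ ⬝ᵥ (d'.m - d.m) ∧ (bary τ ⬝ᵥ (d'.m - d.m) = 0 ↔ τ ⊆ d'.rays) ∧
      bary τ d'.l - bary τ d.l ≤ bary τ ⬝ᵥ (d'.m - d.m) := by
  rw [hS.bary_dotProduct hd hτ]
  refine ⟨sum_nonneg fun k _ => hS.sc_nonneg hd hd' k, ?_, ?_⟩
  · rw [sum_eq_zero_iff_of_nonneg fun k _ => hS.sc_nonneg hd hd' k]
    constructor
    · intro h ρ hρ
      obtain ⟨k, rfl⟩ := mem_rays.1 (hτ hρ)
      exact (hS.sc d hd d' hd' k).1 (h k (by simp [hρ]))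
    · intro h k hk
      exact (hS.sc d hd d' hd' k).2 (h (by simpa using hk))
  · rw [hS.bary_eq_sum hd hτ, Finset.sum_apply, Finset.sum_apply, ← sum_sub_distrib]
    exact sum_le_sum fun k _ => hS.dom d hd d' hd' k

/-- The barycentre of a valid face is a ray of NO cone of the state (freshness). -/
theorem Inv.bary_not_mem_rays (hτ : ValidFace S τ) {d : DCone n} (hd : d ∈ S) : bary τ ∉ d.rays := by
  intro hmem
  obtain ⟨d₀, hd₀, hsub⟩ := hτ.sub
  -- Step 1: the barycentre is a ray of the carrier `d₀`
  have hmem₀ : bary τ ∈ d₀.rays := by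
    obtain ⟨i, hi⟩ := mem_rays.1 hmem
    have h1 : 0 ≤ d.ray i ⬝ᵥ (d₀.m - d.m) := hS.sc_nonneg hd hd₀ i
    have h2 : bary τ ⬝ᵥ (d₀.m - d.m) ≤ 0 := by
      rw [hS.bary_dotProduct hd₀ hsub]
      refine sum_nonpos fun k _ => ?_
      have := hS.sc_nonneg hd₀ hd k
      rw [← neg_sub, dotProduct_neg]; linarith
    rw [hi] at h1
    have h0 : d.ray i ⬝ᵥ (d₀.m - d.m) = 0 := by rw [hi]; exact le_antisymm h2 h1
    rw [← hi]; exact (hS.sc d hd d₀ hd₀ i).1 h0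
  -- Step 2: inside the carrier this contradicts the dual basis
  obtain ⟨k₀, hk₀⟩ := mem_rays.1 hmem₀
  have hin : d₀.ray k₀ ∈ τ := by
    have h := hS.bary_dotProduct_w hd₀ hsub k₀
    rw [← hk₀, hS.dual d₀ hd₀, if_pos rfl] at h
    by_contra hno; rw [if_neg hno] at h; exact one_ne_zero h
  obtain ⟨ρ₁, hρ₁, hne⟩ := exists_mem_ne (s := τ) (lt_of_lt_of_le one_lt_two hτ.two) (d₀.ray k₀)
  obtain ⟨k₁, rfl⟩ := mem_rays.1 (hsub hρ₁)
  have hk : k₀ ≠ k₁ := fun h => hne (by rw [h])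
  have h := hS.bary_dotProduct_w hd₀ hsub k₁
  rw [← hk₀, hS.dual d₀ hd₀, if_neg (Ne.symm hk), if_pos hρ₁] at h
  exact zero_ne_one h

/-- CORE (old ray): strict concavity and domination at an old ray `ρ = d.ray i` of a cone of the star whose vertex is `N·m_d + t`
with `ρ ⬝ᵥ t = 0`, against any cone `c'` of the star. -/
theorem Inv.scdom_old (hτ : ValidFace S τ) {N : ℤ} (hN : 2 * (bnd S τ : ℤ) + 2 ≤ N) {d d' : DCone n} (hd : d ∈ S)
    (hd' : d' ∈ S) (i : Fin n) (t : Fin n → ℤ) (ht : d.ray i ⬝ᵥ t = 0) (c' : DCone n)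
    (hc' : (τ ⊆ d'.rays ∧ ∃ i', d'.ray i' ∈ τ ∧ c' = child N τ d' i') ∨ (¬ τ ⊆ d'.rays ∧ c' = scaleD N d')) :
    (d.ray i ⬝ᵥ (c'.m - (N • d.m + t)) = 0 ↔ d.ray i ∈ c'.rays) ∧
      d.ray i d'.l - d.ray i d.l ≤ d.ray i ⬝ᵥ (c'.m - (N • d.m + t)) := by
  have hG0 : 0 ≤ d.ray i ⬝ᵥ (d'.m - d.m) := hS.sc_nonneg hd hd' i
  have hGiff := hS.sc d hd d' hd' i
  have hdom := hS.dom d hd d' hd' i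
  have hnb : d.ray i ≠ bary τ := fun h => hS.bary_not_mem_rays hτ hd (h ▸ ray_mem_rays d i)
  have hB0 : (0 : ℤ) ≤ bnd S τ := Nat.cast_nonneg _
  rcases hc' with ⟨hsub', i', hi', rfl⟩ | ⟨hnsub', rfl⟩
  · have hX : d.ray i ⬝ᵥ ((child N τ d' i').m - (N • d.m + t)) = N * (d.ray i ⬝ᵥ (d'.m - d.m)) + d.ray i ⬝ᵥ d'.w i' := by
      rw [child_m, show N • d'.m + d'.w i' - (N • d.m + t) = N • (d'.m - d.m) + d'.w i' - t by rw [smul_sub]; abel,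
        dotProduct_sub, dotProduct_add, dotProduct_smul, ht, smul_eq_mul, sub_zero]
    rw [hX]
    have hB := abs_le.1 (abs_dot_w_le (τ := τ) hd' (ray_mem_raysPlus hd i) i')
    by_cases hG : d.ray i ⬝ᵥ (d'.m - d.m) = 0
    · obtain ⟨j, hj⟩ := mem_rays.1 (hGiff.1 hG)
      have hw : d.ray i ⬝ᵥ d'.w i' = if i' = j then 1 else 0 := by rw [← hj]; exact hS.dual d' hd' i' j
      have hY : d.ray i d'.l - d.ray i d.l ≤ 0 := by rw [hG] at hdom; exact hdom
      rw [hG, mul_zero, zero_add, hw]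
      by_cases hji : i' = j
      · rw [if_pos hji]
        refine ⟨⟨fun h => absurd h one_ne_zero, fun hmem => ?_⟩, by linarith⟩
        exfalso
        obtain ⟨k, hk⟩ := mem_rays.1 hmem
        by_cases hk' : k = i'
        · rw [hk', child_ray_self] at hk; exact hnb hk.symm
        · rw [child_ray_of_ne _ _ _ hk'] at hk
          exact hk' ((hS.ray_injective hd' (hk.trans hj.symm)).trans hji.symm)
      · rw [if_neg hji]
        refine ⟨⟨fun _ => mem_rays.2 ⟨j, ?_⟩, fun _ => rfl⟩, by linarith⟩
        rw [child_ray_of_ne _ _ _ (fun h => hji h.symm)]; exact hj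
    · have hG1 : 1 ≤ d.ray i ⬝ᵥ (d'.m - d.m) := by omega
      refine ⟨⟨fun h => ?_, fun hmem => ?_⟩, by nlinarith⟩
      · nlinarith
      · exfalso
        obtain ⟨k, hk⟩ := mem_rays.1 hmem
        by_cases hk' : k = i'
        · rw [hk', child_ray_self] at hk; exact hnb hk.symm
        · rw [child_ray_of_ne _ _ _ hk'] at hk
          exact hG (hGiff.2 (mem_rays.2 ⟨k, hk⟩))
  · have hX : d.ray i ⬝ᵥ ((scaleD N d').m - (N • d.m + t)) = N * (d.ray i ⬝ᵥ (d'.m - d.m)) := by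
      rw [scaleD_m, show N • d'.m - (N • d.m + t) = N • (d'.m - d.m) - t by rw [smul_sub]; abel,
        dotProduct_sub, dotProduct_smul, ht, smul_eq_mul, sub_zero]
    rw [hX, scaleD_rays]
    by_cases hG : d.ray i ⬝ᵥ (d'.m - d.m) = 0
    · rw [hG, mul_zero]; exact ⟨⟨fun _ => hGiff.1 hG, fun _ => rfl⟩, by linarith⟩
    · have hG1 : 1 ≤ d.ray i ⬝ᵥ (d'.m - d.m) := by omega
      refine ⟨⟨fun h => ?_, fun hmem => absurd (hGiff.2 hmem) hG⟩, by nlinarith⟩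
      exfalso
      rcases mul_eq_zero.1 h with h1 | h1
      · omega
      · exact hG h1

/-- CORE (new ray): strict concavity and domination at the barycentre, a ray of the child of `d` at slot `i₀`. -/
theorem Inv.scdom_bary (hτ : ValidFace S τ) {N : ℤ} (hN : 2 * (bnd S τ : ℤ) + 2 ≤ N) {d d' : DCone n} (hd : d ∈ S)
    (hsub : τ ⊆ d.rays) {i₀ : Fin n} (hi₀ : d.ray i₀ ∈ τ) (hd' : d' ∈ S) (c' : DCone n)
    (hc' : (τ ⊆ d'.rays ∧ ∃ i', d'.ray i' ∈ τ ∧ c' = child N τ d' i') ∨ (¬ τ ⊆ d'.rays ∧ c' = scaleD N d')) :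
    (bary τ ⬝ᵥ (c'.m - (N • d.m + d.w i₀)) = 0 ↔ bary τ ∈ c'.rays) ∧
      bary τ d'.l - bary τ d.l ≤ bary τ ⬝ᵥ (c'.m - (N • d.m + d.w i₀)) := by
  obtain ⟨hG0, hGiff, hY⟩ := hS.bary_gap hd hd' hsub
  have hv : bary τ ⬝ᵥ d.w i₀ = 1 := by rw [hS.bary_dotProduct_w hd hsub, if_pos hi₀]
  have hB0 : (0 : ℤ) ≤ bnd S τ := Nat.cast_nonneg _
  rcases hc' with ⟨hsub', i', hi', rfl⟩ | ⟨hnsub', rfl⟩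
  · have hG : bary τ ⬝ᵥ (d'.m - d.m) = 0 := hGiff.2 hsub'
    have hv' : bary τ ⬝ᵥ d'.w i' = 1 := by rw [hS.bary_dotProduct_w hd' hsub', if_pos hi']
    have hX : bary τ ⬝ᵥ ((child N τ d' i').m - (N • d.m + d.w i₀)) = 0 := by
      rw [child_m, show N • d'.m + d'.w i' - (N • d.m + d.w i₀) = N • (d'.m - d.m) + d'.w i' - d.w i₀ by
        rw [smul_sub]; abel, dotProduct_sub, dotProduct_add, dotProduct_smul, hG, hv, hv']; simp
    rw [hX]
    exact ⟨⟨fun _ => mem_rays.2 ⟨i', child_ray_self _ _ _ _⟩, fun _ => rfl⟩, by linarith⟩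
  · have hG : bary τ ⬝ᵥ (d'.m - d.m) ≠ 0 := fun h => hnsub' (hGiff.1 h)
    have hG1 : 1 ≤ bary τ ⬝ᵥ (d'.m - d.m) := by omega
    have hX : bary τ ⬝ᵥ ((scaleD N d').m - (N • d.m + d.w i₀)) = N * (bary τ ⬝ᵥ (d'.m - d.m)) - 1 := by
      rw [scaleD_m, show N • d'.m - (N • d.m + d.w i₀) = N • (d'.m - d.m) - d.w i₀ by rw [smul_sub]; abel,
        dotProduct_sub, dotProduct_smul, hv, smul_eq_mul]
    rw [hX, scaleD_rays]
    refine ⟨⟨fun h => ?_, fun hmem => absurd hmem (hS.bary_not_mem_rays hτ hd')⟩, by nlinarith⟩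
    exfalso; nlinarith

/-- Strict concavity and domination survive a star with scale `N ≥ 2B + 2`. -/
theorem Inv.scdom_dstar (hτ : ValidFace S τ) {N : ℤ} (hN : 2 * (bnd S τ : ℤ) + 2 ≤ N) :
    ∀ c ∈ dstar N S τ, ∀ c' ∈ dstar N S τ, ∀ i,
      (c.ray i ⬝ᵥ (c'.m - c.m) = 0 ↔ c.ray i ∈ c'.rays) ∧ c.ray i c'.l - c.ray i c.l ≤ c.ray i ⬝ᵥ (c'.m - c.m) := by
  intro c hc c' hc' i
  obtain ⟨d, hd, h⟩ := mem_dstar.1 hc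
  obtain ⟨d', hd', h'⟩ := mem_dstar.1 hc'
  have hl' : c'.l = d'.l := by
    rcases h' with ⟨-, i', -, rfl⟩ | ⟨-, rfl⟩ <;> rfl
  rw [hl']
  rcases h with ⟨hsub, i₀, hi₀, rfl⟩ | ⟨hnsub, rfl⟩
  · rw [child_l, child_m]
    by_cases hi : i = i₀
    · subst hi; rw [child_ray_self]; exact hS.scdom_bary hτ hN hd hsub hi₀ hd' c' h'
    · rw [child_ray_of_ne _ _ _ hi]
      exact hS.scdom_old hτ hN hd hd' i (d.w i₀) (by rw [hS.dual d hd, if_neg (Ne.symm hi)]) c' h'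
  · rw [scaleD_l, scaleD_m, scaleD_ray]
    have := hS.scdom_old hτ hN hd hd' i 0 (dotProduct_zero _) c' h'
    rwa [add_zero] at this

/-- CORE (neighbour membership): if `u` satisfies the old-ray inequality on the rays of `d`, pairs to `≥ 1` with the barycentre when
`d` is affected, and is `2B`-bounded, then `N·m_d + u` satisfies the membership inequality against every cone of the star. -/
theorem Inv.amem_core {N : ℤ} (hN : 2 * (bnd S τ : ℤ) + 2 ≤ N) {d : DCone n} (hd : d ∈ S)
    (u : Fin n → ℤ)
    (hu1 : ∀ d'' ∈ S, ∀ j, d''.ray j ∈ d.rays → d''.ray j d.l - d''.ray j d''.l ≤ d''.ray j ⬝ᵥ u)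
    (hu2 : τ ⊆ d.rays → 1 ≤ bary τ ⬝ᵥ u)
    (hu3 : ∀ ρ ∈ raysPlus S τ, |ρ ⬝ᵥ u| ≤ 2 * (bnd S τ : ℤ)) :
    ∀ c'' ∈ dstar N S τ, ∀ j, c''.ray j d.l - c''.ray j c''.l ≤ c''.ray j ⬝ᵥ (N • d.m + u - c''.m) := by
  intro c'' hc'' j
  obtain ⟨d'', hd'', h⟩ := mem_dstar.1 hc''
  have hB0 : (0 : ℤ) ≤ bnd S τ := Nat.cast_nonneg _
  -- the old-ray case, for `ρ' = d''.ray j` with `ρ' ⬝ᵥ t'' = 0`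
  have hold : ∀ t'' : Fin n → ℤ, d''.ray j ⬝ᵥ t'' = 0 →
      d''.ray j d.l - d''.ray j d''.l ≤ d''.ray j ⬝ᵥ (N • d.m + u - (N • d''.m + t'')) := by
    intro t'' ht''
    have hX : d''.ray j ⬝ᵥ (N • d.m + u - (N • d''.m + t'')) = N * (d''.ray j ⬝ᵥ (d.m - d''.m)) + d''.ray j ⬝ᵥ u := by
      rw [show N • d.m + u - (N • d''.m + t'') = N • (d.m - d''.m) + u - t'' by rw [smul_sub]; abel, dotProduct_sub,
        dotProduct_add, dotProduct_smul, ht'', smul_eq_mul, sub_zero]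
    rw [hX]
    have hG0 : 0 ≤ d''.ray j ⬝ᵥ (d.m - d''.m) := hS.sc_nonneg hd'' hd j
    have hdom := hS.dom d'' hd'' d hd j
    have hB := abs_le.1 (hu3 _ (ray_mem_raysPlus hd'' j))
    by_cases hG : d''.ray j ⬝ᵥ (d.m - d''.m) = 0
    · rw [hG, mul_zero, zero_add]
      exact hu1 d'' hd'' j ((hS.sc d'' hd'' d hd j).1 hG)
    · have hG1 : 1 ≤ d''.ray j ⬝ᵥ (d.m - d''.m) := by omega
      nlinarith
  rcases h with ⟨hsub'', i'', hi'', rfl⟩ | ⟨hnsub'', rfl⟩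
  · rw [child_l, child_m]
    by_cases hj : j = i''
    · subst hj
      rw [child_ray_self]
      obtain ⟨hG0, hGiff, hY⟩ := hS.bary_gap hd'' hd hsub''
      have hv'' : bary τ ⬝ᵥ d''.w j = 1 := by rw [hS.bary_dotProduct_w hd'' hsub'', if_pos hi'']
      have hX : bary τ ⬝ᵥ (N • d.m + u - (N • d''.m + d''.w j)) = N * (bary τ ⬝ᵥ (d.m - d''.m)) + bary τ ⬝ᵥ u - 1 := by
        rw [show N • d.m + u - (N • d''.m + d''.w j) = N • (d.m - d''.m) + u - d''.w j by rw [smul_sub]; abel,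
          dotProduct_sub, dotProduct_add, dotProduct_smul, hv'', smul_eq_mul]
      rw [hX]
      have hB := abs_le.1 (hu3 _ (bary_mem_raysPlus S τ))
      by_cases hG : bary τ ⬝ᵥ (d.m - d''.m) = 0
      · rw [hG, mul_zero, zero_add]
        have h1 := hu2 (hGiff.1 hG)
        linarith
      · have hG1 : 1 ≤ bary τ ⬝ᵥ (d.m - d''.m) := by omega
        nlinarith
    · rw [child_ray_of_ne _ _ _ hj]
      exact hold (d''.w i'') (by rw [hS.dual d'' hd'', if_neg (Ne.symm hj)])
  · rw [scaleD_l, scaleD_m, scaleD_ray]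
    have := hold 0 (dotProduct_zero _)
    rwa [add_zero] at this

/-- Neighbour membership survives a star with scale `N ≥ 2B + 2`. -/
theorem Inv.amem_dstar {N : ℤ} (hN : 2 * (bnd S τ : ℤ) + 2 ≤ N) :
    ∀ c ∈ dstar N S τ, ∀ i,
      (∀ c'' ∈ dstar N S τ, ∀ j, c''.ray j c.l - c''.ray j c''.l ≤ c''.ray j ⬝ᵥ (c.m + c.w i - c''.m)) ∨
        ∃ j', c.w i = Pi.single j' 1 - Pi.single c.l 1 := by
  intro c hc i
  obtain ⟨d, hd, h⟩ := mem_dstar.1 hc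
  have hB0 : (0 : ℤ) ≤ bnd S τ := Nat.cast_nonneg _
  -- bounds
  have hBw : ∀ ρ ∈ raysPlus S τ, ∀ k, |ρ ⬝ᵥ d.w k| ≤ (bnd S τ : ℤ) := fun ρ hρ k => abs_dot_w_le hd hρ k
  -- the inequality `hu1` for `u = d.w i` (old-B) and for `u = d.w i` when `w i` is dual (old-A)
  have hu1w : ∀ d'' ∈ S, ∀ j, d''.ray j ∈ d.rays → d''.ray j d.l - d''.ray j d''.l ≤ d''.ray j ⬝ᵥ d.w i := by
    intro d'' hd'' j hmem
    have hG : d''.ray j ⬝ᵥ (d.m - d''.m) = 0 := (hS.sc d'' hd'' d hd j).2 hmem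
    rcases hS.amem d hd i with h1 | ⟨j', hj'⟩
    · have := h1 d'' hd'' j
      rw [show d.m + d.w i - d''.m = (d.m - d''.m) + d.w i by abel, dotProduct_add, hG, zero_add] at this
      exact this
    · obtain ⟨k, hk⟩ := mem_rays.1 hmem
      have hdom := hS.dom d'' hd'' d hd j
      rw [hG] at hdom
      rw [← hk] at hdom ⊢
      rw [hS.dual d hd]
      split_ifs <;> linarith
  rcases h with ⟨hsub, i₀, hi₀, rfl⟩ | ⟨hnsub, rfl⟩
  · rw [child_l, child_m, child_w]
    by_cases hW2 : d.ray i ∈ τ ∧ i ≠ i₀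
    · -- W2: `c.w i = w i − w i₀`, `c.m + c.w i = N·m + w i`
      rw [if_pos hW2]
      left
      rw [show N • d.m + d.w i₀ + (d.w i - d.w i₀) = N • d.m + d.w i by abel]
      refine hS.amem_core hN hd (d.w i) hu1w (fun _ => ?_) fun ρ hρ => ?_
      · rw [hS.bary_dotProduct_w hd hsub, if_pos hW2.1]
      · have := hBw ρ hρ i; linarith [abs_nonneg (ρ ⬝ᵥ d.w i)]
    · rw [if_neg hW2]
      rcases hS.amem d hd i with h1 | ⟨j', hj'⟩
      · -- W1, old-B: `u = w i₀ + w i`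
        left
        rw [show N • d.m + d.w i₀ + d.w i = N • d.m + (d.w i₀ + d.w i) by abel]
        refine hS.amem_core hN hd (d.w i₀ + d.w i) (fun d'' hd'' j hmem => ?_) (fun _ => ?_) fun ρ hρ => ?_
        · obtain ⟨k, hk⟩ := mem_rays.1 hmem
          have h := hu1w d'' hd'' j hmem
          rw [← hk] at h ⊢
          rw [dotProduct_add, hS.dual d hd i₀ k]
          split_ifs <;> linarith
        · rw [dotProduct_add, hS.bary_dotProduct_w hd hsub, hS.bary_dotProduct_w hd hsub, if_pos hi₀]
          split_ifs <;> omega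
        · rw [dotProduct_add]
          have h1 := hBw ρ hρ i₀; have h2 := hBw ρ hρ i
          calc |ρ ⬝ᵥ d.w i₀ + ρ ⬝ᵥ d.w i| ≤ |ρ ⬝ᵥ d.w i₀| + |ρ ⬝ᵥ d.w i| := abs_add_le _ _
            _ ≤ 2 * (bnd S τ : ℤ) := by linarith
      · -- W1, old-A: the dual vector is unchanged
        exact Or.inr ⟨j', hj'⟩
  · rw [scaleD_l, scaleD_m, scaleD_w]
    rcases hS.amem d hd i with h1 | ⟨j', hj'⟩
    · left
      refine hS.amem_core hN hd (d.w i) hu1w (fun hsub => absurd hsub hnsub) fun ρ hρ => ?_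
      have := hBw ρ hρ i; linarith [abs_nonneg (ρ ⬝ᵥ d.w i)]
    · exact Or.inr ⟨j', hj'⟩

/-- ★ THE STAR STEP: the invariant bundle survives the star subdivision at a valid face, with scale `N ≥ 2B + 2`. -/
theorem inv_dstar (hτ : ValidFace S τ) {N : ℤ} (hN : 2 * (bnd S τ : ℤ) + 2 ≤ N) : Inv (dstar N S τ) := by
  have hB0 : (0 : ℤ) ≤ bnd S τ := Nat.cast_nonneg _
  exact
    { nonneg := hS.nonneg_dstar hτ N
      stdOrPos := hS.stdOrPos_dstar hτ N
      dual := hS.dual_dstar N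
      lmin := hS.lmin_dstar N
      bdry := hS.bdry_dstar hτ N
      mnonneg := hS.mnonneg_dstar (by linarith)
      mlpos := hS.mlpos_dstar (by linarith)
      sc := fun c hc c' hc' i => (hS.scdom_dstar hτ hN c hc c' hc' i).1
      dom := fun c hc c' hc' i => (hS.scdom_dstar hτ hN c hc c' hc' i).2
      amem := hS.amem_dstar hN
      complete := hS.complete_dstar hτ N }

end sc

end Summit.ResolutionOfSingularities.ResolutionOfSingularities.Theorems.FInjectiveMacaulayfication.F108Toric

end
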